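import Summits.CriticalPhenomena.PercolationContinuityZ3.Theorems.Transplant.FKConnectivityAllQFastEvalClusters
import Mathlib.Combinatorics.Colex
import HarnessLib

/-!
# The fast kernel evaluator, file 3: the mask bridge for fibre counts and the binary-split sum

Support file (`--supports stmt-CriticalPhenomena-4575`), FK sub-lane `prim-bschramm-fk-1` (gen 17) of the post-continuity programme;
builds on p205010 (kernel theorem, internal audit signed; external expert review pending).  No definitions, no named facts, no sorries;
standard axioms.  Continues `…FastEval.lean` / `…FastEvalClusters.lean`:
* masks `a < 2^d` ↔ sub-configurations of the first `d` listed pairs (`tOf_subset_firstT`, `tOf_xor` for the complementary mask,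
  `testBit_maskOf` / `tOf_maskOf` / `maskOf_lt` through Mathlib's `Finset.equivBitIndices`, `eq_of_tOf_eq`);
* **`fibreCount_conf_eq_card`** / **`fibreCount_conf_eq_card_bool`**: on the fibre `(conf (firstT d), ∅)` the lineage's `fibreCount M ∅ A B`
  (fk-1 g13) is the number of masks `a < 2^d` with `conf (tOf a) ∈ A` and `conf (tOf ((2^d−1) xor a)) ∈ B` (a `Finset.card_bij`);
* `sumR_eq` (`sumR F d b = Σ_{a<2^d} F (b+a)`), `sumR_succ` / `sumR_split` (one split, with syntactic numerals), `card_filter_range_eq_sumR`,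
  and **`three_counts_eq_sumR`**: `#{g₁} + #{g₂} + (2^d − #{g₃})` as ONE binary-split sum of `[g₁] + [g₂] + [¬g₃]` — so that an
  inequality `#{g₁} + #{g₂} ≤ #{g₃}` is refuted by a single `decide +kernel` evaluation.
[cite: Linusson2011, Prop. 2.6] [cite: Grimmett2006, §1.2 eq. (1.1) (p. 4)]
-/

namespace Summit.CriticalPhenomena.PercolationContinuityZ3.Theorems

namespace FK

namespace RCEval

open Literature.Probability.LatticeModels Literature.Probability.Percolation
open scoped Classical

variable {D : RCEval}

/-! ### Masks versus sub-configurations of the first `d` listed pairs -/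

/-- Membership in `firstT`. [folklore] -/
@[simp] theorem mem_firstT (d : ℕ) (i : Fin D.m) : i ∈ D.firstT d ↔ i.val < d := by
  unfold firstT; simp

/-- `conf` is monotone. [folklore] -/
theorem conf_mono {s t : Finset (Fin D.m)} (h : s ⊆ t) : D.conf s ⊆ D.conf t := by
  unfold conf
  exact Finset.coe_subset.2 (Finset.image_subset_image h)

/-- `conf` of a difference (valid data). [folklore] -/
theorem conf_sdiff (hD : D.Valid) (s t : Finset (Fin D.m)) : D.conf (t \ s) = D.conf t \ D.conf s := by
  ext g
  rw [Set.mem_sdiff]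
  unfold conf
  simp only [Finset.coe_image, Set.mem_image, Finset.mem_coe, Finset.mem_sdiff]
  constructor
  · rintro ⟨i, ⟨hit, his⟩, rfl⟩
    exact ⟨⟨i, hit, rfl⟩, fun ⟨j, hjs, hji⟩ => his (hD.1 hji ▸ hjs)⟩
  · rintro ⟨⟨i, hit, rfl⟩, hnot⟩
    exact ⟨i, ⟨hit, fun his => hnot ⟨i, his, rfl⟩⟩, rfl⟩

/-- A mask below `2^d` opens only the first `d` pairs. [folklore] -/
theorem tOf_subset_firstT {d a : ℕ} (ha : a < 2 ^ d) : D.tOf a ⊆ D.firstT d := by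
  intro i hi
  rw [mem_tOf] at hi
  rw [mem_firstT]
  by_contra hle
  rw [not_lt] at hle
  have : a.testBit i.val = false := Nat.testBit_lt_two_pow (lt_of_lt_of_le ha (Nat.pow_le_pow_right (by norm_num) hle))
  rw [this] at hi; exact Bool.false_ne_true hi

/-- The complementary mask opens the complementary pairs among the first `d`. [folklore] -/
theorem tOf_xor (d a : ℕ) (ha : a < 2 ^ d) : D.tOf (Nat.xor (2 ^ d - 1) a) = D.firstT d \ D.tOf a := by
  ext i
  rw [mem_tOf, Finset.mem_sdiff, mem_firstT, mem_tOf, Nat.xor_eq, Nat.testBit_xor, Nat.testBit_two_pow_sub_one]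
  by_cases hi : i.val < d
  · simp [hi]
  · have : a.testBit i.val = false :=
      Nat.testBit_lt_two_pow (lt_of_lt_of_le ha (Nat.pow_le_pow_right (by norm_num) (not_lt.1 hi)))
    simp [hi, this]

/-- Bits of `maskOf t`. [folklore] -/
theorem testBit_maskOf (t : Finset (Fin D.m)) (j : ℕ) : (D.maskOf t).testBit j = true ↔ ∃ i ∈ t, i.val = j := by
  unfold maskOf
  have hsum : ∑ i ∈ t, 2 ^ i.val = ∑ j ∈ t.map Fin.valEmbedding, 2 ^ j := by
    rw [Finset.sum_map]; rfl
  have key : (∑ j ∈ t.map Fin.valEmbedding, 2 ^ j).bitIndices.toFinset = t.map Fin.valEmbedding := by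
    have := Finset.equivBitIndices.apply_symm_apply (t.map Fin.valEmbedding)
    rwa [Finset.equivBitIndices_symm_apply, Finset.equivBitIndices_apply] at this
  have hmem : j ∈ (∑ j ∈ t.map Fin.valEmbedding, 2 ^ j).bitIndices.toFinset ↔ j ∈ t.map Fin.valEmbedding := by rw [key]
  rw [List.mem_toFinset, Nat.mem_bitIndices, Finset.mem_map] at hmem
  rw [hsum, hmem]
  exact ⟨fun ⟨i, hi, h⟩ => ⟨i, hi, h⟩, fun ⟨i, hi, h⟩ => ⟨i, hi, h⟩⟩

/-- `tOf (maskOf t) = t`. [folklore] -/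
theorem tOf_maskOf (t : Finset (Fin D.m)) : D.tOf (D.maskOf t) = t := by
  ext i
  rw [mem_tOf, testBit_maskOf]
  exact ⟨fun ⟨i', hi', h⟩ => Fin.ext h ▸ hi', fun h => ⟨i, h, rfl⟩⟩

/-- A set of indices below `d` has mask below `2^d`. [folklore] -/
theorem maskOf_lt {d : ℕ} {t : Finset (Fin D.m)} (ht : t ⊆ D.firstT d) : D.maskOf t < 2 ^ d := by
  refine Nat.lt_pow_two_of_testBit _ fun j hj => ?_
  cases h : (D.maskOf t).testBit j
  · rfl
  · exfalso
    obtain ⟨i, hi, rfl⟩ := (testBit_maskOf t j).1 h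
    have := (mem_firstT d i).1 (ht hi)
    omega

/-- Two masks below `2^d` (`d ≤ m`) with the same open pairs are equal. [folklore] -/
theorem eq_of_tOf_eq {d a a' : ℕ} (hd : d ≤ D.m) (ha : a < 2 ^ d) (ha' : a' < 2 ^ d) (h : D.tOf a = D.tOf a') : a = a' := by
  refine Nat.eq_of_testBit_eq fun j => ?_
  by_cases hj : j < D.m
  · have h1 := mem_tOf a ⟨j, hj⟩
    have h2 := mem_tOf a' ⟨j, hj⟩
    rw [h] at h1
    have key : a.testBit j = true ↔ a'.testBit j = true := h1.symm.trans h2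
    exact Bool.eq_iff_iff.2 key
  · rw [not_lt] at hj
    have hle : 2 ^ d ≤ 2 ^ j := Nat.pow_le_pow_right (by norm_num) (le_trans hd hj)
    rw [Nat.testBit_lt_two_pow (lt_of_lt_of_le ha hle), Nat.testBit_lt_two_pow (lt_of_lt_of_le ha' hle)]

/-- A sub-configuration of `M` has `ω ∆ M = M ∖ ω`. [folklore] -/
theorem symmDiff_eq_sdiff_of_subset {ω M : BondConfig (Fin D.n)} (h : ω ⊆ M) : symmDiff ω M = M \ ω := by
  rw [Set.symmDiff_def, Set.sdiff_eq_empty.2 h, Set.empty_union]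

/-- **The mask bridge for fibre counts**: on the fibre `(M, ∅)` with `M` the configuration of the first `d ≤ m` listed pairs,
`fibreCount M ∅ A B` counts the masks `a < 2^d` whose configuration lies in `A` and whose complementary configuration lies in `B`.
[cite: Linusson2011, Prop. 2.6] -/
theorem fibreCount_conf_eq_card (hD : D.Valid) {d : ℕ} (hd : d ≤ D.m) (A B : Set (BondConfig (Fin D.n))) :
    fibreCount (D.conf (D.firstT d)) ∅ A B =
      ((Finset.range (2 ^ d)).filter fun a => D.conf (D.tOf a) ∈ A ∧ D.conf (D.tOf (Nat.xor (2 ^ d - 1) a)) ∈ B).card := by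
  unfold fibreCount
  symm
  refine Finset.card_bij (fun a _ => D.conf (D.tOf a)) (fun a ha => ?_) (fun a₁ ha₁ a₂ ha₂ h => ?_) (fun ω hω => ?_)
  · rw [Finset.mem_filter] at ha
    obtain ⟨ha, hA, hB⟩ := ha
    rw [Finset.mem_range] at ha
    have hsub : D.conf (D.tOf a) ⊆ D.conf (D.firstT d) := conf_mono (tOf_subset_firstT ha)
    refine Finset.mem_filter.2 ⟨Finset.mem_univ _, Set.sdiff_eq_empty.2 hsub, hA, ?_⟩
    rw [symmDiff_eq_sdiff_of_subset hsub, ← conf_sdiff hD, ← tOf_xor d a ha]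
    exact hB
  · rw [Finset.mem_filter, Finset.mem_range] at ha₁ ha₂
    exact eq_of_tOf_eq hd ha₁.1 ha₂.1 (conf_injective hD h)
  · rw [Finset.mem_filter] at hω
    obtain ⟨-, hωM, hA, hB⟩ := hω
    have hsub : ω ⊆ D.conf (D.firstT d) := Set.sdiff_eq_empty.1 hωM
    obtain ⟨t, rfl⟩ := exists_conf_eq_of_subset (hsub.trans (conf_subset_range _))
    have ht : t ⊆ D.firstT d := fun i hi => (edge_mem_conf hD (D.firstT d) i).1 (hsub ((edge_mem_conf hD t i).2 hi))
    have hlt : D.maskOf t < 2 ^ d := maskOf_lt ht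
    refine ⟨D.maskOf t, Finset.mem_filter.2 ⟨Finset.mem_range.2 hlt, ?_, ?_⟩, by rw [tOf_maskOf]⟩
    · rw [tOf_maskOf]; exact hA
    · rw [tOf_xor d _ hlt, tOf_maskOf, conf_sdiff hD, ← symmDiff_eq_sdiff_of_subset hsub]
      exact hB

/-- **The mask bridge, Boolean form**: if a Boolean `g` decides the two membership conditions for every mask below `2^d`, the fibre
count is the number of masks with `g a = true`. [cite: Linusson2011, Prop. 2.6] -/
theorem fibreCount_conf_eq_card_bool (hD : D.Valid) {d : ℕ} (hd : d ≤ D.m) {A B : Set (BondConfig (Fin D.n))} (g : ℕ → Bool)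
    (hg : ∀ a, a < 2 ^ d → ((D.conf (D.tOf a) ∈ A ∧ D.conf (D.tOf (Nat.xor (2 ^ d - 1) a)) ∈ B) ↔ g a = true)) :
    fibreCount (D.conf (D.firstT d)) ∅ A B = ((Finset.range (2 ^ d)).filter fun a => g a = true).card := by
  rw [fibreCount_conf_eq_card hD hd]
  congr 1
  exact Finset.filter_congr fun a ha => hg a (Finset.mem_range.1 ha)

/-! ### The binary-split sum -/

/-- One split of the binary sum (definitional). [folklore] -/
theorem sumR_succ (F : ℕ → ℕ) (d b : ℕ) : sumR F (d + 1) b = sumR F d b + sumR F d (b + 2 ^ d) := rfl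

/-- One split of the binary sum with the index arithmetic supplied as hypotheses, so that instances on numerals are SYNTACTIC (keeps the
elaborator from unfolding the summands while unifying numerals). [folklore] -/
theorem sumR_split (F : ℕ → ℕ) {d d' b c : ℕ} (hd : d' = d + 1) (hc : c = b + 2 ^ d) : sumR F d' b = sumR F d b + sumR F d c := by
  subst hd; subst hc; rfl

/-- `sumR F d b = Σ_{a < 2^d} F (b + a)`. [folklore] -/
theorem sumR_eq (F : ℕ → ℕ) (d b : ℕ) : sumR F d b = ∑ a ∈ Finset.range (2 ^ d), F (b + a) := by
  induction d generalizing b with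
  | zero => simp [sumR]
  | succ d ih =>
    rw [sumR, ih, ih, pow_succ, mul_two, Finset.sum_range_add]
    simp only [add_assoc]

/-- A count of masks below `2^d` is a binary-split sum of indicators. [folklore] -/
theorem card_filter_range_eq_sumR (d : ℕ) (P : ℕ → Prop) [DecidablePred P] :
    ((Finset.range (2 ^ d)).filter P).card = sumR (fun a => if P a then 1 else 0) d 0 := by
  rw [sumR_eq, Finset.card_filter]
  simp only [zero_add]

/-- **Three Boolean counts as one binary-split sum**: `#{g₁} + #{g₂} + (2^d − #{g₃}) = Σ_a ([g₁ a] + [g₂ a] + [¬ g₃ a])`, and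
`#{g₃} ≤ 2^d` (used to read `bad + sq ≤ good` off a single kernel evaluation). [folklore] -/
theorem three_counts_eq_sumR (d : ℕ) (g₁ g₂ g₃ : ℕ → Bool) :
    ((Finset.range (2 ^ d)).filter fun a => g₁ a = true).card + ((Finset.range (2 ^ d)).filter fun a => g₂ a = true).card +
          (2 ^ d - ((Finset.range (2 ^ d)).filter fun a => g₃ a = true).card) =
        sumR (fun a => cond (g₁ a) 1 0 + cond (g₂ a) 1 0 + cond (g₃ a) 0 1) d 0 ∧
      ((Finset.range (2 ^ d)).filter fun a => g₃ a = true).card ≤ 2 ^ d := by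
  have hsplit := Finset.card_filter_add_card_filter_not (s := Finset.range (2 ^ d)) (fun a => g₃ a = true)
  rw [Finset.card_range] at hsplit
  refine ⟨?_, by omega⟩
  have hnot : 2 ^ d - ((Finset.range (2 ^ d)).filter fun a => g₃ a = true).card =
      ((Finset.range (2 ^ d)).filter fun a => ¬ g₃ a = true).card := by omega
  rw [hnot, Finset.card_filter, Finset.card_filter, Finset.card_filter, ← Finset.sum_add_distrib, ← Finset.sum_add_distrib,
    sumR_eq]
  refine Finset.sum_congr rfl fun a _ => ?_
  rw [zero_add]
  cases g₁ a <;> cases g₂ a <;> cases g₃ a <;> simp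

end RCEval

end FK

end Summit.CriticalPhenomena.PercolationContinuityZ3.Theorems
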